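import Mathlib
import Summits.KontsevichZagierPeriods.Zeta5Search.WedgeDictionaryQuadratic
import Summits.KontsevichZagierPeriods.Zeta5Search.WedgeDictionaryFull
import Summits.KontsevichZagierPeriods.Zeta5Search.WedgeDictionaryEdge
import HarnessLib

/-!
# Closed forms for the wedge-square dictionary: the Casoratian `M₃(b)` and Brown–Zudilin's `Q(a)` as a
# terminating very-well-poised `₉F₈(1)`

Cell `pub-zeta5` (HONEST FRAMING: systematic search; no irrationality claim unless certified), planner seat
`pub-zeta5-gen-1` generation 4 (staged for the typer / prover seats; the planner cannot file).  THIS IS NOT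
LITERATURE: the closed forms below are OUR conjectures (internally minted, found by exact computation 2026-08-20,
verified instances only), hence `@[conjecture]` and under `Summits/…`.

With `n = b₀`, `S = Σ_j b_j`, `d = 3n − S` and the terminating very-well-poised sum
`Ω(b) = Σ_{m ≥ 0} (1 − 2m/(n+1)) · (−n−1)_m / m! · ∏_{j=1}^{7} (−b_j)_m / (b_j − n)_m`
(a terminating `₉F₈(1)` with parameters `a = −n−1, 1 + a/2, −b_1, …, −b_7`; the terms with `m > min_j b_j` vanish):

* `casoratianClosedForm` (CF-M3): on the box `0 ≤ b_j ≤ n`, `b_j + b_k ≤ n (j ≠ k)`, `S ≤ 3n`,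
  `M₃(b) · n! · ∏_{j<k} (n − b_j − b_k)! = (−1)^n · 4 · d! · ∏_j (n − b_j)! · Ω(b)`
  (`M₃ = quadM3`, the j-free form of `U(b)W(b+e_j) − U(b+e_j)W(b)`, `wedgeQ_eq_quadM3`).  At the corner `b = (n;0⁷)`
  it is the PROVED `cornerIdentity` (`M₃ = (−1)^n 4 (3n)!/n!^15`, `WedgeDictionaryCornerIdentity`).
* `casoratianVanishing`: `M₃(b) = 0` as soon as one pair sum `b_j + b_k` exceeds `n` (then every pole of `R_b` has
  order `≤ 4`, so `U(b) = U(b+e_j) = 0`; expected to be a routine consequence of the partial-fraction set-up).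
* `QWedgeClosedForm` (CF-Q): for `a` in the region of `wedgeDictionary` with `b = b(a)` and `b_j + b_k ≤ n` for the six
  pairs `16,17,27,35,45,46` of (35),
  `Q(a) · n! · b₁! b₄! b₅! b₆! b₇! · ∏_{(j,k) ∈ {16,17,27,35,45,46}} (n − b_j − b_k)! = (−1)^{n+S} · ∏_j (n − b_j)! · Ω(b)`;
  `QWedgeVanishing`: `Q(a) = 0` when one of those six pair sums exceeds `n` (every term of the double sum (17) vanishes).
* `casoratianClosedForm_bCorner`, `casoratianClosedForm_bCorner'` (PROVED here): CF-M3 holds on the two infinite families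
  already settled in the tree — the corner `(n;0⁷)` (`cornerIdentity`, `quadM3_bCorner`) and P1's edge `(n;1,0⁶)`
  (`WedgeDictionaryEdge.quadM3_bCorner'`) — i.e. the conjecture's normalisation (sign, `d!`, the 21 pair factorials) is the
  one the proved cases satisfy.
* `qPart_of_closedForms` (PROVED here, bookkeeping): the four statements imply the `Q`-part of `wedgeDictionary` in its
  j-free form `Q(a) = ρ(a)·M₃(b(a))` (`Q_part_iff_quadM3`) on the whole region — the fifteen `E`-pair factorials, `d!`
  and the `4` of `rhoOf` cancel.

Evidence (not proof; exact rational arithmetic; two implementations of `M₃` — partial fractions (typer `pfdata.py`)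
and the rank-two reduction of gen-1 g4 — and gen-1's implementation of (17)): CF-Q at 1838 wedge points
(exhaustive on `a ∈ [0,2]⁸`, random on `[0,6]⁸`, `[0,8]⁸`), 0 failures, the 166 vanishing cases all termwise and all
explained by `QWedgeVanishing`; CF-M3 on 478 parameter vectors (`n ≤ 13`, 70 of them outside the wedge
`2b_j ≤ n+1`), 0 failures; `casoratianVanishing` / `U = 0` on 480 + 78 + 320 vectors, 0 failures.
Files: `run/shared/lean/pub/pub-zeta5/code/gen1/g4/`, `run/shared/lean/pub/pub-zeta5/pub-zeta5-gen-1/PROOF-NOTES-g4.md`.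
-/

noncomputable section

open Finset Polynomial

namespace Summit.KontsevichZagierPeriods.Zeta5Search.WedgeDictionary

open Summit.KontsevichZagierPeriods.Zeta5Search.DualSeries
open Literature.NumberTheory.Irrationality.BrownZudilin2022 (bOfA Converges convergenceForms QOf)

/-- The terminating very-well-poised sum `Ω(b) = Σ_{m=0}^{n} (1 − 2m/(n+1))·(−n−1)_m/m!·∏_{j=1}^{7} (−b_j)_m/(b_j−n)_m`
(`n = b₀`; `(x)_m` the rising factorial `ascPochhammer`; every term with `m > min_j b_j` vanishes, and on the box of
`casoratianClosedForm` no denominator vanishes before a numerator does). -/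
def omegaVWP (b : ℕ → ℤ) : ℚ :=
  ∑ m ∈ range ((b 0).toNat + 1),
    (1 - 2 * (m : ℚ) / ((b 0 : ℚ) + 1)) * ((ascPochhammer ℚ m).eval (-(b 0 : ℚ) - 1) / (m.factorial : ℚ)) *
      ∏ j ∈ range 7, (ascPochhammer ℚ m).eval (-(b (j + 1) : ℚ)) / (ascPochhammer ℚ m).eval ((b (j + 1) : ℚ) - b 0)

/-- The 21 pairs `j < k` from `{1,…,7}`. -/
def allPairs : List (ℕ × ℕ) :=
  [(1,2),(1,3),(1,4),(1,5),(1,6),(1,7),(2,3),(2,4),(2,5),(2,6),(2,7),(3,4),(3,5),(3,6),(3,7),(4,5),(4,6),(4,7),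
   (5,6),(5,7),(6,7)]

/-- The six pairs `16,17,27,35,45,46` of (35) of arXiv:2210.03391 (the complement of `Epairs` in `allPairs`). -/
def nonEpairs : List (ℕ × ℕ) := [(1,6),(1,7),(2,7),(3,5),(4,5),(4,6)]

/-- **CONJECTURE CF-M3 (closed form of the Casoratian; INTERNALLY MINTED — verified instances only).**
For integer parameters with `0 ≤ b_j ≤ b₀`, `b_j + b_k ≤ b₀ (j < k)` and `d(b) = 3b₀ − Σ b_j ≥ 0`:
`M₃(b) · b₀! · ∏_{j<k} (b₀ − b_j − b_k)! = (−1)^{b₀} · 4 · d! · ∏_j (b₀ − b_j)! · Ω(b)`. -/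
@[conjecture] def casoratianClosedForm : Prop :=
  ∀ b : ℕ → ℤ, InBox b → 0 ≤ dOf b → (∀ j ∈ Icc 1 7, b j ≤ b 0) →
    (∀ jk ∈ allPairs, b jk.1 + b jk.2 ≤ b 0) →
    quadM3 b * (((b 0).toNat.factorial : ℚ) *
        (allPairs.map fun jk => ((b 0 - b jk.1 - b jk.2).toNat.factorial : ℚ)).prod) =
      (-1 : ℚ) ^ (b 0).toNat * 4 * ((dOf b).toNat.factorial : ℚ) *
        (∏ j ∈ range 7, ((b 0 - b (j + 1)).toNat.factorial : ℚ)) * omegaVWP b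

/-- **CONJECTURE (vanishing of the Casoratian; INTERNALLY MINTED — verified instances only, expected routine).**
On the same box but with one pair sum `b_j + b_k > b₀`, `M₃(b) = 0` (all poles of `R_b` and `R_{b+e_1}` then have order
`≤ 4`, so `U(b) = U(b + e_1) = 0`). -/
@[conjecture] def casoratianVanishing : Prop :=
  ∀ b : ℕ → ℤ, InBox b → 0 ≤ dOf b → (∀ j ∈ Icc 1 7, b j ≤ b 0) →
    (∃ jk ∈ allPairs, b 0 < b jk.1 + b jk.2) → quadM3 b = 0

/-- **CONJECTURE CF-Q (closed form of Brown–Zudilin's `Q(a)` on the wedge; INTERNALLY MINTED — verified instances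
only).**  For `a` in the region of `wedgeDictionary` (`Converges a`, `0 ≤ 2b_i ≤ b₀+1`, `d ≥ 0`) whose six pair sums
`b_j + b_k`, `(j,k) ∈ {16,17,27,35,45,46}`, are `≤ b₀` (the other fifteen are `≤ b₀` by convergence):
`Q(a) · b₀! · b₁! b₄! b₅! b₆! b₇! · ∏_{(j,k)} (b₀ − b_j − b_k)! = (−1)^{b₀ + Σ b_j} · ∏_j (b₀ − b_j)! · Ω(b)`. -/
@[conjecture] def QWedgeClosedForm : Prop :=
  ∀ a : Fin 8 → ℤ, Converges a →
    (∀ i ∈ Icc 1 7, 0 ≤ bOfA a i ∧ 2 * bOfA a i ≤ bOfA a 0 + 1) → 0 ≤ dOf (bOfA a) →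
    (∀ jk ∈ nonEpairs, bOfA a jk.1 + bOfA a jk.2 ≤ bOfA a 0) →
    (QOf a : ℚ) * ((((bOfA a 0).toNat.factorial : ℚ) *
        (([1, 4, 5, 6, 7] : List ℕ).map fun j => ((bOfA a j).toNat.factorial : ℚ)).prod) *
        (nonEpairs.map fun jk => ((bOfA a 0 - bOfA a jk.1 - bOfA a jk.2).toNat.factorial : ℚ)).prod) =
      (-1 : ℚ) ^ ((bOfA a 0).toNat + (∑ j ∈ range 7, bOfA a (j + 1)).toNat) *
        (∏ j ∈ range 7, ((bOfA a 0 - bOfA a (j + 1)).toNat.factorial : ℚ)) * omegaVWP (bOfA a)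

/-- **CONJECTURE (vanishing of `Q` on the wedge; INTERNALLY MINTED — verified instances only, expected routine:
every term of the double sum (17) vanishes).**  In the region of `wedgeDictionary`, if one of the six pair sums
`b_j + b_k`, `(j,k) ∈ {16,17,27,35,45,46}`, exceeds `b₀`, then `Q(a) = 0`. -/
@[conjecture] def QWedgeVanishing : Prop :=
  ∀ a : Fin 8 → ℤ, Converges a →
    (∀ i ∈ Icc 1 7, 0 ≤ bOfA a i ∧ 2 * bOfA a i ≤ bOfA a 0 + 1) → 0 ≤ dOf (bOfA a) →
    (∃ jk ∈ nonEpairs, bOfA a 0 < bOfA a jk.1 + bOfA a jk.2) → QOf a = 0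

/-- The fifteen `E`-pair sums are `≤ b₀` on the convergence cone (they are convergence forms (3)). -/
theorem epairs_le_of_converges (a : Fin 8 → ℤ) (hconv : Converges a) :
    ∀ jk ∈ Epairs, bOfA a jk.1 + bOfA a jk.2 ≤ bOfA a 0 := by
  have hf : ∀ x ∈ convergenceForms a, 0 ≤ x := hconv
  have h0 : 0 ≤ a 0 := hf _ (by simp [convergenceForms])
  have h2 : 0 ≤ a 2 := hf _ (by simp [convergenceForms])
  have h4 : 0 ≤ a 4 := hf _ (by simp [convergenceForms])
  have h5 : 0 ≤ a 5 := hf _ (by simp [convergenceForms])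
  have h6 : 0 ≤ a 6 := hf _ (by simp [convergenceForms])
  have h042 : 0 ≤ a 0 + a 4 - a 2 := hf _ (by simp [convergenceForms])
  have h257 : 0 ≤ a 2 + a 5 - a 7 := hf _ (by simp [convergenceForms])
  have h3467 : 0 ≤ a 3 + a 4 + a 6 + a 7 - a 1 - a 2 - a 5 := hf _ (by simp [convergenceForms])
  have h675 : 0 ≤ a 6 + a 7 - a 5 := hf _ (by simp [convergenceForms])
  have h371 : 0 ≤ a 3 + a 7 - a 1 := hf _ (by simp [convergenceForms])
  have h12537 : 0 ≤ a 1 + a 2 + a 5 - a 3 - a 7 := hf _ (by simp [convergenceForms])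
  have h072 : 0 ≤ a 0 + a 7 - a 2 := hf _ (by simp [convergenceForms])
  have h013 : 0 ≤ a 0 + a 1 - a 3 := hf _ (by simp [convergenceForms])
  have h341 : 0 ≤ a 3 + a 4 - a 1 := hf _ (by simp [convergenceForms])
  have h3677 : 0 ≤ a 3 + a 6 + 2 * a 7 - a 1 - a 2 - a 5 := hf _ (by simp [convergenceForms])
  intro jk hjk
  simp only [Epairs, List.mem_cons, List.mem_nil_iff, or_false] at hjk
  rcases hjk with rfl | rfl | rfl | rfl | rfl | rfl | rfl | rfl | rfl | rfl | rfl | rfl | rfl | rfl | rfl <;>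
    simp only [bOfA] <;> linarith

/-- **Bookkeeping (PROVED): the two closed forms and the two vanishing statements give the `Q`-part of
`wedgeDictionary` in its j-free form `Q(a) = ρ(a)·M₃(b(a))` (`Q_part_iff_quadM3`) on the whole region.** -/
theorem qPart_of_closedForms (hM : casoratianClosedForm) (hMv : casoratianVanishing) (hQ : QWedgeClosedForm)
    (hQv : QWedgeVanishing) (a : Fin 8 → ℤ) (hconv : Converges a)
    (hreg : ∀ i ∈ Icc 1 7, 0 ≤ bOfA a i ∧ 2 * bOfA a i ≤ bOfA a 0 + 1) (hd : 0 ≤ dOf (bOfA a)) :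
    (QOf a : ℚ) = rhoOf a * quadM3 (bOfA a) := by
  have hnn : ∀ i ∈ Icc 1 7, 0 ≤ bOfA a i := fun i hi => (hreg i hi).1
  obtain ⟨hIB, hle⟩ := inBox_of_full a hconv hnn
  have hE := epairs_le_of_converges a hconv
  by_cases hne : ∀ jk ∈ nonEpairs, bOfA a jk.1 + bOfA a jk.2 ≤ bOfA a 0
  · -- all 21 pair sums are ≤ b₀
    have hall : ∀ jk ∈ allPairs, bOfA a jk.1 + bOfA a jk.2 ≤ bOfA a 0 := by
      intro jk hjk
      simp only [allPairs, List.mem_cons, List.mem_nil_iff, or_false] at hjk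
      rcases hjk with rfl | rfl | rfl | rfl | rfl | rfl | rfl | rfl | rfl | rfl | rfl | rfl | rfl | rfl | rfl | rfl |
          rfl | rfl | rfl | rfl | rfl
      exacts [hE (1,2) (by simp [Epairs]), hE (1,3) (by simp [Epairs]), hE (1,4) (by simp [Epairs]),
        hE (1,5) (by simp [Epairs]), hne (1,6) (by simp [nonEpairs]), hne (1,7) (by simp [nonEpairs]),
        hE (2,3) (by simp [Epairs]), hE (2,4) (by simp [Epairs]), hE (2,5) (by simp [Epairs]), hE (2,6) (by simp [Epairs]),
        hne (2,7) (by simp [nonEpairs]), hE (3,4) (by simp [Epairs]), hne (3,5) (by simp [nonEpairs]),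
        hE (3,6) (by simp [Epairs]), hE (3,7) (by simp [Epairs]), hne (4,5) (by simp [nonEpairs]),
        hne (4,6) (by simp [nonEpairs]), hE (4,7) (by simp [Epairs]), hE (5,6) (by simp [Epairs]), hE (5,7) (by simp [Epairs]),
        hE (6,7) (by simp [Epairs])]
    have h1 := hM (bOfA a) hIB hd hle hall
    have h2 := hQ a hconv hreg hd hne
    have hX : ((((bOfA a 0).toNat.factorial : ℚ) *
        (([1, 4, 5, 6, 7] : List ℕ).map fun j => ((bOfA a j).toNat.factorial : ℚ)).prod) *
        (nonEpairs.map fun jk => ((bOfA a 0 - bOfA a jk.1 - bOfA a jk.2).toNat.factorial : ℚ)).prod) ≠ 0 := by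
      simp only [nonEpairs, List.map, List.prod_cons, List.prod_nil]
      positivity
    have hZ : (((bOfA a 0).toNat.factorial : ℚ) *
        (allPairs.map fun jk => ((bOfA a 0 - bOfA a jk.1 - bOfA a jk.2).toNat.factorial : ℚ)).prod) ≠ 0 := by
      simp only [allPairs, List.map, List.prod_cons, List.prod_nil]
      positivity
    have hq := eq_div_of_mul_eq hX h2
    have hm := eq_div_of_mul_eq hZ h1
    rw [hq, hm]
    simp only [rhoOf, Epairs, allPairs, nonEpairs, List.map, List.prod_cons, List.prod_nil, mul_one, pow_add]
    field_simp
  · push Not at hne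
    obtain ⟨jk, hjk, hlt⟩ := hne
    have hQ0 : QOf a = 0 := hQv a hconv hreg hd ⟨jk, hjk, hlt⟩
    have hjk' : jk ∈ allPairs := by
      simp only [nonEpairs, List.mem_cons, List.mem_nil_iff, or_false] at hjk
      rcases hjk with rfl | rfl | rfl | rfl | rfl | rfl <;> simp [allPairs]
    have hM0 : quadM3 (bOfA a) = 0 := hMv (bOfA a) hIB hd hle ⟨jk, hjk', hlt⟩
    simp [hQ0, hM0]

/-! ### Sanity values of `Ω` (found by computation, gen-1 g4): `Ω(n;0⁷) = 1`, `Ω(3;1⁷) = 1 − 2·1/2⁷·… = 63/64`. -/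


/-! ### Consistency with the two PROVED infinite families (corner `(n;0⁷)` and edge `(n;1,0⁶)`)

`casoratianClosedForm` specialises to `cornerIdentity` (`WedgeDictionaryCornerIdentity.quadM3_bCorner`) and to P1's
edge theorem (`WedgeDictionaryEdge.quadM3_bCorner'`): on both families `Ω = 1` and the factorial bookkeeping matches.
These are theorems (instances of the conjecture), not evidence by computation. -/

/-- `Ω(b) = 1` as soon as one of `b₁,…,b₇` vanishes (only the `m = 0` term survives). -/
theorem omegaVWP_eq_one {b : ℕ → ℤ} {j : ℕ} (hj : j ∈ range 7) (hb : b (j + 1) = 0) : omegaVWP b = 1 := by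
  unfold omegaVWP
  rw [sum_eq_single 0]
  · simp
  · intro m _ hm
    have h0 : (ascPochhammer ℚ m).eval (-(b (j + 1) : ℚ)) = 0 := by
      rw [hb]; push_cast; rw [neg_zero, ascPochhammer_eval_zero]; simp [hm]
    rw [prod_eq_zero hj (by rw [h0, zero_div])]
    ring
  · intro h; simp at h

/-- Values of the corner vector. -/
theorem bCorner_apply' (n j : ℕ) : bCorner n j = if j = 0 then (n : ℤ) else 0 := rfl

/-- Values of the edge vector `b' = (n;1,0⁶)`. -/
theorem bCorner'_apply' (n j : ℕ) : bCorner' n j = if j = 1 then 1 else if j = 0 then (n : ℤ) else 0 := by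
  unfold bCorner'
  rw [Function.update_apply]
  split_ifs with h1 <;> simp [bCorner_apply', *]

/-- **CF-M3 holds on the corner family** `b = (n;0⁷)`, `n ≥ 1` (from the PROVED `cornerIdentity`). -/
theorem casoratianClosedForm_bCorner (n : ℕ) :
    quadM3 (bCorner n) * ((((bCorner n 0).toNat.factorial : ℚ)) *
        (allPairs.map fun jk => (((bCorner n 0 - bCorner n jk.1 - bCorner n jk.2).toNat.factorial : ℚ))).prod) =
      (-1 : ℚ) ^ (bCorner n 0).toNat * 4 * ((dOf (bCorner n)).toNat.factorial : ℚ) *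
        (∏ j ∈ range 7, (((bCorner n 0 - bCorner n (j + 1)).toNat.factorial : ℚ))) * omegaVWP (bCorner n) := by
  rw [quadM3_bCorner, dOf_bCorner, omegaVWP_eq_one (show 0 ∈ range 7 by simp) (by simp [bCorner_apply'])]
  have hd : (3 * (n : ℤ)).toNat = 3 * n := by
    rw [show (3 * (n : ℤ)) = ((3 * n : ℕ) : ℤ) by push_cast; ring, Int.toNat_natCast]
  simp only [allPairs, List.map, List.prod_cons, List.prod_nil, prod_range_succ, prod_range_zero, bCorner_apply',
    if_true, Int.toNat_natCast, hd]
  norm_num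
  have hf : (n.factorial : ℚ) ≠ 0 := by positivity
  field_simp

/-- **CF-M3 holds on the edge family** `b = (n;1,0⁶)`, `n ≥ 1` (from P1's PROVED `quadM3_bCorner'`). -/
theorem casoratianClosedForm_bCorner' (n : ℕ) (hn : 1 ≤ n) :
    quadM3 (bCorner' n) * ((((bCorner' n 0).toNat.factorial : ℚ)) *
        (allPairs.map fun jk => (((bCorner' n 0 - bCorner' n jk.1 - bCorner' n jk.2).toNat.factorial : ℚ))).prod) =
      (-1 : ℚ) ^ (bCorner' n 0).toNat * 4 * ((dOf (bCorner' n)).toNat.factorial : ℚ) *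
        (∏ j ∈ range 7, (((bCorner' n 0 - bCorner' n (j + 1)).toNat.factorial : ℚ))) * omegaVWP (bCorner' n) := by
  obtain ⟨k, rfl⟩ : ∃ k, n = k + 1 := ⟨n - 1, by omega⟩
  rw [quadM3_bCorner' (k + 1) hn, dOf_bCorner',
    omegaVWP_eq_one (show 1 ∈ range 7 by simp) (by simp [bCorner'_apply'])]
  have hd : (3 * (((k + 1 : ℕ)) : ℤ) - 1).toNat = 3 * k + 2 := by
    rw [show (3 * ((k + 1 : ℕ) : ℤ) - 1) = ((3 * k + 2 : ℕ) : ℤ) by push_cast; ring, Int.toNat_natCast]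
  have h1 : (((k + 1 : ℕ) : ℤ) - 1).toNat = k := by
    rw [show (((k + 1 : ℕ) : ℤ) - 1) = ((k : ℕ) : ℤ) by push_cast; ring, Int.toNat_natCast]
  simp only [allPairs, List.map, List.prod_cons, List.prod_nil, prod_range_succ, prod_range_zero, bCorner'_apply',
    if_true, hd]
  norm_num
  have f3 : ((3 * (k + 1)).factorial : ℚ) = (3 * (k : ℚ) + 3) * ((3 * k + 2).factorial : ℚ) := by
    rw [show 3 * (k + 1) = (3 * k + 2) + 1 by ring]; simp only [Nat.factorial_succ]; push_cast; ring
  have f1 : ((k + 1).factorial : ℚ) = ((k : ℚ) + 1) * (k.factorial : ℚ) := by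
    simp only [Nat.factorial_succ]; push_cast; ring
  rw [f3, f1]
  have hf : (k.factorial : ℚ) ≠ 0 := by positivity
  have hf2 : ((3 * k + 2).factorial : ℚ) ≠ 0 := by positivity
  have hk : (k : ℚ) + 1 ≠ 0 := by positivity
  field_simp

example : omegaVWP (fun i => if i = 0 then 3 else 0) = 1 := by
  simp [omegaVWP, Finset.sum_range_succ, ascPochhammer_succ_left, ascPochhammer_zero]

example : omegaVWP (fun i => if i = 0 then 3 else if i ≤ 7 then 1 else 0) = 63 / 64 := by
  simp [omegaVWP, Finset.sum_range_succ, Finset.prod_range_succ, ascPochhammer_succ_left, ascPochhammer_zero]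
  norm_num

end Summit.KontsevichZagierPeriods.Zeta5Search.WedgeDictionary
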